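import Literature.NumberTheory.GaloisRepresentations.LubinTateColemanSeries
import HarnessLib

/-!
# `𝒰 ≅ ℳ_f`: norm-coherent units of the Lubin–Tate tower are the `𝒩`-invariant unit power series

De Shalit, *Iwasawa theory of elliptic curves with complex multiplication* (1987), Ch. I §2.2–2.3 and
III §1.1 (where `𝒰 = lim← U_n` is identified with power series through Coleman's theorem); Coleman 1979,
Thm. A: **`β ↦ g_β` is a bijection from the norm-coherent sequences of units of the tower `K_π^{m+1}` onto
`{g ∈ 𝒪_F⟦X⟧ˣ : 𝒩 g = g}`**, with inverse `g ↦ (g(ω_{m+1}))_m`. For `f = πX + X^q` over a non-archimedean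
local field `F` (everything **proved**):

* `NormCoherentUnits.ofSeries g` — the norm-coherent sequence `(g(ω_{m+1}))_m` of an `𝒩`-invariant unit
  series (`towerNorm_evalAt_cohPt_eq`; the values are units because `g(ω) ≡ g(0) mod 𝔪`).
* ★ `colemanEquiv hπ : NormCoherentUnits hπ ≃ {g // 𝒩 g = g ∧ g(0) ∈ 𝒪_Fˣ}` — **Coleman's theorem as a
  bijection**, `β ↦ g_β`, inverse `g ↦ (g(ω_{m+1}))_m`; multiplicative (`colemanSeries_mul`).

## References

* E. de Shalit, *Iwasawa theory of elliptic curves with complex multiplication* (1987), Ch. I §2.2–2.3.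
  [cite: deShalit1987, Ch. I §2.2 Theorem]
* R. Coleman, *Division values in local fields*, Invent. Math. 53 (1979), Thm. A.

## Mathlib reuse

`Equiv`, `IsUltrametricDist.norm_add_eq_max_of_norm_ne_norm`; from the tree: `LubinTateColemanSeries.lean`
(`NormCoherentUnits`, `colemanSeries`, `eq_colemanSeries`, `evalAt_cohPt_colemanSeries`),
`LubinTateColemanInterpolationNorm.lean` (`towerNorm_evalAt_cohPt_eq`, `norm_evalAt_sub_constantCoeff_le`),
`LubinTateNormOperator.lean` (`norm_algebraMap_LTCoeff`), `LubinTateColemanZeros.lean` (`norm_coe_eq_one_of_isUnit`).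
-/

noncomputable section

open Filter Topology Polynomial ValuativeRel
open scoped PowerSeries.WithPiTopology

namespace Literature.NumberTheory.GaloisRepresentations

section LocalFieldCE

open GaloisRepresentations.IsNonarchimedeanLocalField LubinTate

variable (F : Type*) [Field F] [ValuativeRel F] [TopologicalSpace F] [IsNonarchimedeanLocalField F]

attribute [local instance] ltNormUniformSpace ltNormIsUniformAddGroup rk1 nF nE fintypeResidueField

variable {F}
variable {π : 𝒪[F]} (hπ : (valuation F).IsUniformizer (π : F))

include hπ in
/-- **Values of a unit series at points are units**: `‖g(x)‖ = 1` when `g(0) ∈ 𝒪_Fˣ` (`g(x) ≡ g(0) mod 𝔪`).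
[cite: deShalit1987, Ch. I §2.2] -/
theorem norm_evalAt_eq_one_of_isUnit {E : IntermediateField F (AlgebraicClosure F)} [FiniteDimensional F E]
    {g : PowerSeries (LTCoeff F)} (hg : IsUnit (PowerSeries.constantCoeff g)) (x : (maxNilIdeal F E).toIdeal) :
    ‖((evalAt (maxNilIdeal F E) x g : unitBall E) : E)‖ = 1 := by
  have hlt := lt_of_le_of_lt (norm_evalAt_sub_constantCoeff_le hπ g x) x.2
  set A := ((evalAt (maxNilIdeal F E) x g : unitBall E) : E)
  set B := ((algebraMap (LTCoeff F) (unitBall E) (PowerSeries.constantCoeff g) : unitBall E) : E)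
  have hB : ‖B‖ = 1 := by
    have e : PowerSeries.constantCoeff g = LTCoeff.of F ((LTCoeff.of F).symm (PowerSeries.constantCoeff g)) :=
      (RingEquiv.apply_symm_apply _ _).symm
    change ‖((algebraMap (LTCoeff F) (unitBall E) (PowerSeries.constantCoeff g) : unitBall E) : E)‖ = 1
    rw [e, norm_algebraMap_LTCoeff]
    exact norm_coe_eq_one_of_isUnit (hg.map _)
  have hne : ‖B‖ ≠ ‖A - B‖ := by rw [hB]; exact (ne_of_lt hlt).symm
  have e2 : A = B + (A - B) := by ring
  rw [e2, IsUltrametricDist.norm_add_eq_max_of_norm_ne_norm hne, hB]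
  exact max_eq_left hlt.le

/-- **The norm-coherent sequence `(g(ω_{m+1}))_m` of an `𝒩`-invariant unit series** (de Shalit Cor. 2.3 (ii)
read backwards, via `towerNorm_evalAt_cohPt_eq`). [cite: deShalit1987, Ch. I §2.3 (ii)] -/
def NormCoherentUnits.ofSeries (g : PowerSeries (LTCoeff F)) (hg : colemanNorm hπ 0 g = g)
    (hu : IsUnit (PowerSeries.constantCoeff g)) : NormCoherentUnits hπ where
  val m := evalAt (maxNilIdeal F (ltField π m)) (cohPt hπ m) g
  norm_eq_one _ := norm_evalAt_eq_one_of_isUnit hπ hu _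
  coherent _ _ hnm := towerNorm_evalAt_cohPt_eq hπ hg hnm

/-- Components of `ofSeries g` (unfolding). [cite: deShalit1987, Ch. I §2.3 (ii)] -/
@[simp] theorem NormCoherentUnits.val_ofSeries (g : PowerSeries (LTCoeff F)) (hg : colemanNorm hπ 0 g = g)
    (hu : IsUnit (PowerSeries.constantCoeff g)) (m : ℕ) :
    (NormCoherentUnits.ofSeries hπ g hg hu).val m = evalAt (maxNilIdeal F (ltField π m)) (cohPt hπ m) g := rfl

/-- `g_{(g(ω_{m+1}))_m} = g` for an `𝒩`-invariant unit series `g`. [cite: deShalit1987, Ch. I §2.2 Theorem] -/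
theorem colemanSeries_ofSeries (g : PowerSeries (LTCoeff F)) (hg : colemanNorm hπ 0 g = g)
    (hu : IsUnit (PowerSeries.constantCoeff g)) :
    colemanSeries hπ (NormCoherentUnits.ofSeries hπ g hg hu) = g :=
  (eq_colemanSeries hπ fun _ => rfl).symm

/-- `(g_β(ω_{m+1}))_m = β`. [cite: deShalit1987, Ch. I §2.2 Theorem] -/
theorem ofSeries_colemanSeries (β : NormCoherentUnits hπ) :
    NormCoherentUnits.ofSeries hπ (colemanSeries hπ β) (colemanNorm_colemanSeries hπ β)
      (isUnit_constantCoeff_colemanSeries hπ β) = β :=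
  NormCoherentUnits.ext fun m => evalAt_cohPt_colemanSeries hπ β m

/-- ★ **Coleman's theorem as a bijection `𝒰 ≅ ℳ_f`**: norm-coherent unit sequences of the Lubin–Tate tower
`↔` `𝒩`-invariant unit power series, `β ↦ g_β`, `g ↦ (g(ω_{m+1}))_m`.
[cite: deShalit1987, Ch. I §2.2 Theorem] -/
def colemanEquiv : NormCoherentUnits hπ ≃
    {g : PowerSeries (LTCoeff F) // colemanNorm hπ 0 g = g ∧ IsUnit (PowerSeries.constantCoeff g)} where
  toFun β := ⟨colemanSeries hπ β, colemanNorm_colemanSeries hπ β, isUnit_constantCoeff_colemanSeries hπ β⟩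
  invFun g := NormCoherentUnits.ofSeries hπ g.1 g.2.1 g.2.2
  left_inv β := ofSeries_colemanSeries hπ β
  right_inv g := Subtype.ext (colemanSeries_ofSeries hπ g.1 g.2.1 g.2.2)

/-- `colemanEquiv β = g_β` (unfolding). [cite: deShalit1987, Ch. I §2.2 Theorem] -/
@[simp] theorem coe_colemanEquiv (β : NormCoherentUnits hπ) :
    ((colemanEquiv hπ β : {g : PowerSeries (LTCoeff F) //
      colemanNorm hπ 0 g = g ∧ IsUnit (PowerSeries.constantCoeff g)}) : PowerSeries (LTCoeff F)) =
      colemanSeries hπ β := rfl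

/-- **`colemanEquiv` is multiplicative**: `g_{ββ'} = g_β g_{β'}`. [cite: deShalit1987, Ch. I §2.3 (i)] -/
theorem coe_colemanEquiv_mul (β β' : NormCoherentUnits hπ) :
    ((colemanEquiv hπ (β.mul β') : {g : PowerSeries (LTCoeff F) //
      colemanNorm hπ 0 g = g ∧ IsUnit (PowerSeries.constantCoeff g)}) : PowerSeries (LTCoeff F)) =
      colemanSeries hπ β * colemanSeries hπ β' :=
  colemanSeries_mul hπ β β'

end LocalFieldCE

end Literature.NumberTheory.GaloisRepresentations
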